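import Summits.CriticalPhenomena.PercolationContinuityZ3.Theorems.PercNearOneGluingNoHeavyLowerTailLossyPocketCoverKN
import HarnessLib

/-!
# `NoHeavyLowerTail` (stmt-CriticalPhenomena-4575) — the pocket cover with a slack of ANY SIGN (signed cover core)

Support file (engine seat `prim-cplus-engine` g5; `--supports stmt-CriticalPhenomena-4575`).  No definitions, no
named facts, no sorries.

The tree's lossy pocket cover (`LossyPocket.term_le_add_of_inside`, `LossyPocket.lowerTail_le_add_of_inside`, g2/g3) asks the
per-state slack to be NONNEGATIVE.  Nonnegativity is used only on the states where the transfer hypothesis is void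
(`R = ∅` or `c ∈ R`); on the realised states with `R ≠ ∅`, `c ∉ R` a slack of any sign is fine.  This matters for the
SIGNED quantitative slack of `…SignedBlockTransferInside.lean` (a gain when the witness is the more fragile vertex) and for
the full credit `−μ{c small in G[Wᶜ]+K_R}` on the states with more than `j` ports:

* `LossyPocket.term_le_signed_of_inside` — one pocket state;
* `LossyPocket.lowerTail_le_signed_of_inside` — the summed cover `μ{1 ≤ N ≤ j} ≤ μ({o ↔ A} ∩ {|π(c)| ≤ j}) + Σ Δ(W,R)·μ(P_{W,R})`
  for any `Δ` that pays the glued-block transfer inside `Wᶜ` on the realised states with `R ≠ ∅`, `c ∉ R` and is `≥ 0` where `R = ∅` or `c ∈ R`.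
The signed quantitative cover `bad ≤ LLQ(c)` (`…SignedPocketCover.lean`) and the typed reduction SQC ⇒ crux are built on it
(engine memo `ENGINE-g5.md` §3).
-/

noncomputable section

namespace Summit.CriticalPhenomena.PercolationContinuityZ3.Theorems

open MeasureTheory Set Literature.Probability.LatticeModels Literature.Probability.Percolation
open scoped Classical BigOperators

namespace LossyPocket

variable {n : ℕ}

/-- **One pocket state of the signed cover.**  Fix `o ∉ A`, `c ∈ A`, data `(W, N)` and a slack `δ` of ANY SIGN,
nonnegative if `N = ∅` or `c ∈ N`, such that — if the data are realised, `N ≠ ∅` and `c ∉ N` —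
`μ{glued port block j-small inside Wᶜ} ≤ μ{c j-small in G[Wᶜ] + K_N} + δ`.  Then
`μ(P_{W,N} ∩ {1 ≤ N_o ≤ j}) ≤ μ(P_{W,N} ∩ {o ↔ A} ∩ {|π(c)| ≤ j}) + δ·μ(P_{W,N})`.
(The tree's `term_le_add_of_inside` with the sign hypothesis weakened to where it is used.) [this work] -/
theorem term_le_signed_of_inside (w : Sym2 (Fin n) → unitInterval) (A : Finset (Fin n)) (o c : Fin n) (j : ℕ)
    (hoA : o ∉ A) (hc : c ∈ A) (W N : Finset (Fin n)) {δ : ℝ} (hδ : N = ∅ ∨ c ∈ N → 0 ≤ δ)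
    (hyp : ({ω : BondConfig (Fin n) |
          (Finset.univ.filter fun v => ω ∈ openConnIn ((↑A : Set (Fin n))ᶜ) o v) = W ∧
          (A.filter fun a => ω ∈ openConnIn (insert a ((↑A : Set (Fin n))ᶜ)) o a) = N} : Set _).Nonempty →
      N.Nonempty → c ∉ N →
        (prodBernoulli w).real {ω : BondConfig (Fin n) |
            (A.filter fun y => ∃ a ∈ N, ω ∈ openConnIn ((↑W : Set (Fin n))ᶜ) a y).card ≤ j} ≤
          (prodBernoulli w).real {ω : BondConfig (Fin n) |
            ((∃ a ∈ N, ω ∈ openConnIn ((↑W : Set (Fin n))ᶜ) c a) ∧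
                (A.filter fun y => ∃ a ∈ N, ω ∈ openConnIn ((↑W : Set (Fin n))ᶜ) a y).card ≤ j) ∨
              ((¬ ∃ a ∈ N, ω ∈ openConnIn ((↑W : Set (Fin n))ᶜ) c a) ∧
                (A.filter fun y => ω ∈ openConnIn ((↑W : Set (Fin n))ᶜ) c y).card ≤ j)} + δ) :
    (prodBernoulli w).real
        ({ω : BondConfig (Fin n) |
            (Finset.univ.filter fun v => ω ∈ openConnIn ((↑A : Set (Fin n))ᶜ) o v) = W ∧
            (A.filter fun a => ω ∈ openConnIn (insert a ((↑A : Set (Fin n))ᶜ)) o a) = N} ∩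
          {ω : BondConfig (Fin n) | 1 ≤ (A.filter fun x => ω ∈ openConn o x).card ∧
            (A.filter fun x => ω ∈ openConn o x).card ≤ j}) ≤
      (prodBernoulli w).real
          ({ω : BondConfig (Fin n) |
              (Finset.univ.filter fun v => ω ∈ openConnIn ((↑A : Set (Fin n))ᶜ) o v) = W ∧
              (A.filter fun a => ω ∈ openConnIn (insert a ((↑A : Set (Fin n))ᶜ)) o a) = N} ∩
            ((⋃ a' ∈ A, (openConn o a' : Set (BondConfig (Fin n)))) ∩
              {ω : BondConfig (Fin n) | (A.filter fun x => ω ∈ openConn c x).card ≤ j})) +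
        δ * (prodBernoulli w).real
          {ω : BondConfig (Fin n) |
            (Finset.univ.filter fun v => ω ∈ openConnIn ((↑A : Set (Fin n))ᶜ) o v) = W ∧
            (A.filter fun a => ω ∈ openConnIn (insert a ((↑A : Set (Fin n))ᶜ)) o a) = N} := by
  set μ := prodBernoulli w with hμ
  set bad : Set (BondConfig (Fin n)) := {ω | 1 ≤ (A.filter fun x => ω ∈ openConn o x).card ∧
    (A.filter fun x => ω ∈ openConn o x).card ≤ j} with hbad
  set U : Set (BondConfig (Fin n)) := ⋃ a' ∈ A, (openConn o a' : Set (BondConfig (Fin n))) with hU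
  set Sc : Set (BondConfig (Fin n)) := {ω | (A.filter fun x => ω ∈ openConn c x).card ≤ j} with hSc
  set PK : Set (BondConfig (Fin n)) :=
    {ω | (Finset.univ.filter fun v => ω ∈ openConnIn ((↑A : Set (Fin n))ᶜ) o v) = W ∧
      (A.filter fun a => ω ∈ openConnIn (insert a ((↑A : Set (Fin n))ᶜ)) o a) = N} with hPK
  rcases Set.eq_empty_or_nonempty PK with hPe | ⟨ω₀, hω₀⟩
  · rw [hPe, empty_inter, empty_inter, measureReal_empty, mul_zero, add_zero]
  rcases N.eq_empty_or_nonempty with hNe | hNne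
  · rw [show PK ∩ bad = ∅ from lowerTail_inter_pocket_empty A o W N hoA hNe j, measureReal_empty]
    have hδ0 : 0 ≤ δ := hδ (Or.inl hNe)
    have := mul_nonneg hδ0 (measureReal_nonneg (μ := μ) (s := PK))
    linarith [measureReal_nonneg (μ := μ) (s := PK ∩ (U ∩ Sc))]
  by_cases hcN : c ∈ N
  · have hsub := lowerTail_inter_pocket_subset_of_mem A o W N hcN j
    have hδ0 : 0 ≤ δ := hδ (Or.inr hcN)
    have := mul_nonneg hδ0 (measureReal_nonneg (μ := μ) (s := PK))
    linarith [measureReal_mono (μ := μ) hsub]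
  -- the main case: `N ≠ ∅`, `c ∉ N`, realised data (here `δ` may be negative)
  set BLK : Set (BondConfig (Fin n)) := {ω |
    (A.filter fun y => ∃ a ∈ N, ω ∈ openConnIn ((↑W : Set (Fin n))ᶜ) a y).card ≤ j} with hBLK
  set CSM : Set (BondConfig (Fin n)) := {ω |
    ((∃ a ∈ N, ω ∈ openConnIn ((↑W : Set (Fin n))ᶜ) c a) ∧
        (A.filter fun y => ∃ a ∈ N, ω ∈ openConnIn ((↑W : Set (Fin n))ᶜ) a y).card ≤ j) ∨
      ((¬ ∃ a ∈ N, ω ∈ openConnIn ((↑W : Set (Fin n))ᶜ) c a) ∧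
        (A.filter fun y => ω ∈ openConnIn ((↑W : Set (Fin n))ᶜ) c y).card ≤ j)} with hCSM
  have hE1 : PK ∩ bad = PK ∩ BLK := lowerTail_inter_pocket A o W N hoA hNne j
  have hPU : PK ⊆ U := by
    intro ω hω
    obtain ⟨a, ha⟩ := hNne
    exact mem_iUnion₂.2 ⟨a, (contacts_subset A o W N hω ha).1, reachable_of_mem_contacts A o W N hω ha⟩
  have hE2 : PK ∩ (U ∩ Sc) = PK ∩ CSM := by
    rw [← relaySmall_inter_pocket A o W N hoA hc j]
    ext ω
    exact ⟨fun ⟨h1, _, h3⟩ => ⟨h1, h3⟩, fun ⟨h1, h3⟩ => ⟨h1, hPU h1, h3⟩⟩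
  set F : Finset (Sym2 (Fin n)) := Finset.univ.filter fun e : Sym2 (Fin n) => ∃ x ∈ W, x ∈ e with hF
  set F' : Finset (Sym2 (Fin n)) := Finset.univ.filter fun e : Sym2 (Fin n) => ∀ x ∈ e, x ∉ W with hF'
  have hdisj : Disjoint F F' := by
    rw [Finset.disjoint_left]
    intro e he he'
    obtain ⟨x, hxW, hxe⟩ := (Finset.mem_filter.1 he).2
    exact (Finset.mem_filter.1 he').2 x hxe hxW
  have hPdet : DeterminedBy PK (↑F : Set (Sym2 (Fin n))) := pocketMarkov_determinedBy_pocketEvent A o W N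
  have hfacB : μ.real (PK ∩ BLK) = μ.real PK * μ.real BLK :=
    prodBernoulli_real_inter_of_determinedBy_disjoint w hdisj hPdet (LossyPocketT.determinedBy_blockSmall A W N j)
      (Set.toFinite _).measurableSet (Set.toFinite _).measurableSet
  have hfacC : μ.real (PK ∩ CSM) = μ.real PK * μ.real CSM :=
    prodBernoulli_real_inter_of_determinedBy_disjoint w hdisj hPdet (LossyPocketT.determinedBy_gluedSmall A W N c j)
      (Set.toFinite _).measurableSet (Set.toFinite _).measurableSet
  have htr : μ.real BLK ≤ μ.real CSM + δ := hyp ⟨ω₀, hω₀⟩ hNne hcN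
  rw [hE1, hE2, hfacB, hfacC]
  have hP0 : 0 ≤ μ.real PK := measureReal_nonneg
  calc μ.real PK * μ.real BLK ≤ μ.real PK * (μ.real CSM + δ) := mul_le_mul_of_nonneg_left htr hP0
    _ = μ.real PK * μ.real CSM + δ * μ.real PK := by ring

/-- **The signed pocket cover, abstract transfer.**  `o ∉ A`, `c ∈ A` fixed, `Δ(W,R)` a slack of ANY SIGN on the
realised states with `R ≠ ∅`, `c ∉ R` (where it must pay the transfer
`μ{port block j-small inside Wᶜ} ≤ μ{c j-small in G[Wᶜ] + K_R} + Δ(W,R)`) and nonnegative on the states with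
`R = ∅` or `c ∈ R`.  Then `μ{1 ≤ N ≤ j} ≤ μ({o ↔ A} ∩ {|π(c)| ≤ j}) + Σ_{W,R} Δ(W,R)·μ(P_{W,R})`. [this work] -/
theorem lowerTail_le_signed_of_inside (w : Sym2 (Fin n) → unitInterval) (A : Finset (Fin n)) (o c : Fin n) (j : ℕ)
    (hoA : o ∉ A) (hc : c ∈ A) (Δ : Finset (Fin n) → Finset (Fin n) → ℝ)
    (hΔ0 : ∀ W N : Finset (Fin n), N = ∅ ∨ c ∈ N → 0 ≤ Δ W N)
    (hΔ : ∀ W N : Finset (Fin n),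
      ({ω : BondConfig (Fin n) |
          (Finset.univ.filter fun v => ω ∈ openConnIn ((↑A : Set (Fin n))ᶜ) o v) = W ∧
          (A.filter fun a => ω ∈ openConnIn (insert a ((↑A : Set (Fin n))ᶜ)) o a) = N} : Set _).Nonempty →
      N.Nonempty → c ∉ N →
        (prodBernoulli w).real {ω : BondConfig (Fin n) |
            (A.filter fun y => ∃ a ∈ N, ω ∈ openConnIn ((↑W : Set (Fin n))ᶜ) a y).card ≤ j} ≤
          (prodBernoulli w).real {ω : BondConfig (Fin n) |
            ((∃ a ∈ N, ω ∈ openConnIn ((↑W : Set (Fin n))ᶜ) c a) ∧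
                (A.filter fun y => ∃ a ∈ N, ω ∈ openConnIn ((↑W : Set (Fin n))ᶜ) a y).card ≤ j) ∨
              ((¬ ∃ a ∈ N, ω ∈ openConnIn ((↑W : Set (Fin n))ᶜ) c a) ∧
                (A.filter fun y => ω ∈ openConnIn ((↑W : Set (Fin n))ᶜ) c y).card ≤ j)} + Δ W N) :
    (prodBernoulli w).real {ω : BondConfig (Fin n) |
        1 ≤ (A.filter fun x => ω ∈ openConn o x).card ∧ (A.filter fun x => ω ∈ openConn o x).card ≤ j} ≤
      (prodBernoulli w).real ((⋃ a' ∈ A, (openConn o a' : Set (BondConfig (Fin n)))) ∩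
          {ω : BondConfig (Fin n) | (A.filter fun x => ω ∈ openConn c x).card ≤ j}) +
        ∑ W : Finset (Fin n), ∑ N : Finset (Fin n), Δ W N *
          (prodBernoulli w).real {ω : BondConfig (Fin n) |
            (Finset.univ.filter fun v => ω ∈ openConnIn ((↑A : Set (Fin n))ᶜ) o v) = W ∧
            (A.filter fun a => ω ∈ openConnIn (insert a ((↑A : Set (Fin n))ᶜ)) o a) = N} := by
  set μ := prodBernoulli w with hμ
  set bad : Set (BondConfig (Fin n)) := {ω | 1 ≤ (A.filter fun x => ω ∈ openConn o x).card ∧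
    (A.filter fun x => ω ∈ openConn o x).card ≤ j} with hbad
  set U : Set (BondConfig (Fin n)) := ⋃ a' ∈ A, (openConn o a' : Set (BondConfig (Fin n))) with hU
  set Sc : Set (BondConfig (Fin n)) := {ω | (A.filter fun x => ω ∈ openConn c x).card ≤ j} with hSc
  set PK : Finset (Fin n) → Finset (Fin n) → Set (BondConfig (Fin n)) := fun W N =>
    {ω | (Finset.univ.filter fun v => ω ∈ openConnIn ((↑A : Set (Fin n))ᶜ) o v) = W ∧
      (A.filter fun a => ω ∈ openConnIn (insert a ((↑A : Set (Fin n))ᶜ)) o a) = N} with hPK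
  have key : ∀ W N : Finset (Fin n),
      μ.real (PK W N ∩ bad) ≤ μ.real (PK W N ∩ (U ∩ Sc)) + Δ W N * μ.real (PK W N) :=
    fun W N => term_le_signed_of_inside w A o c j hoA hc W N (hΔ0 W N) (hΔ W N)
  rw [pocketReduction_sum_pocketEvent w A o bad, pocketReduction_sum_pocketEvent w A o (U ∩ Sc)]
  calc ∑ W : Finset (Fin n), ∑ N : Finset (Fin n), μ.real (PK W N ∩ bad)
      ≤ ∑ W : Finset (Fin n), ∑ N : Finset (Fin n),
          (μ.real (PK W N ∩ (U ∩ Sc)) + Δ W N * μ.real (PK W N)) :=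
        Finset.sum_le_sum fun W _ => Finset.sum_le_sum fun N _ => key W N
    _ = (∑ W : Finset (Fin n), ∑ N : Finset (Fin n), μ.real (PK W N ∩ (U ∩ Sc))) +
          ∑ W : Finset (Fin n), ∑ N : Finset (Fin n), Δ W N * μ.real (PK W N) := by
        simp only [Finset.sum_add_distrib]

end LossyPocket

end Summit.CriticalPhenomena.PercolationContinuityZ3.Theorems

end
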